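import Summits.QuantumFields.BalabanUV.T4Continuum.Spine.NE3.SlicePoincareSlicB8Flat
import Summits.QuantumFields.BalabanUV.T4Continuum.Support.NE3SquaredTentBump
import Summits.QuantumFields.BalabanUV.T4Continuum.Support.NE3SlicePoincareSkeleton
import Summits.QuantumFields.BalabanUV.T4Continuum.Support.NE3FrameFreeDecompositionPrep
import Summits.QuantumFields.BalabanUV.T4Continuum.Support.AveragingDeficitHSInner
import Summits.QuantumFields.BalabanUV.T4Continuum.Support.NE3CoarseInterpolant
import Summits.QuantumFields.BalabanUV.T4Continuum.Support.NE3BlockLineAverage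
import HarnessLib

/-!
# T⁴ programme, node NE3 — census R38 (file 1∕2): FLAT BLOCK-HARMONIC FIELDS — the Laplacian of `g = F + Δ_1μ` under B8's (1.38)-orthogonality is
# BLOCK-CONSTANT, and the INVERSE INEQUALITY `Σ‖block means of Δ_1g‖² · M^{d+4} ≲ Σ‖g‖²` (squared-tent test function)

Cell `pub-balaban-gaps` (YM blitz, track G2, seat `ne3`, unit `pub-balaban-gaps-ne3-g8`; writer prover-pub-balaban-gaps-ne3-g8-0, 2026-08-24), census
`run/shared/lean/pub/pub-balaban-gaps/ne/NE3.md` §4 R38, §14.  WHY.  After R37 (`LandauCorrectionSupB8FlatH0`: (H0) at `U = 1` for every `(L, N, j)`) the flat-datum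
`hK` of THE END on a torus of size `N ≥ 2` rests on ONE displayed fact, (HR): the `ℓ^∞ → ℓ^∞` bound of B8's projection `R(1)` onto `Δ_1N(Q′(1))`
([Balaban1985BackgroundPropagators] (3.25)∕(3.49) at `U = 1`, TYPE).  File 2∕2 (`LandauProjectionSupFlat`) proves it; THIS FILE supplies its two structural
inputs about `g := F + Δ_1μ` (`M = L^{j+1}`, everything at the flat background, `hsR`-sums over the period box):

* §0 `sum_hsR_covLapSite_comm` ∕ `sum_hsR_covLapSite_eq_sum_gaugeDir` — symmetry of `Δ_1` and `Σ hsR (Δ_1f) g = Σ Σ_κ hsR (D_1f)(D_1g)` (summation by parts,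
  `NE3LandauOrbit.sum_hsR_gaugeDir` at `W = 1`).
* §1 **`covLapSite_eq_blockMean`** — if `g` is skew, `(N·M)`-periodic and `Σ hsR g (Δ_1ν) = 0` for all `ν ∈ N(Q′(1)) = avgKernelGauges L N (j+1) 1`, then
  `Δ_1 g = a ∘ blk_M` with `a` the `M`-block means of `Δ_1g` («`g` is block-harmonic»): `Δ_1g − a∘blk` is a member of `N(Q′(1))`, orthogonal to `Δ_1g` (symmetry)
  and to the block-constant `a∘blk` (block sums), hence to itself.
* §2 **`blockMean_energy_le`** — THE INVERSE INEQUALITY: for `(N·M)`-periodic `g` with `Δ_1g = a∘blk_M`, `a` `N`-periodic, `M ≥ 2`: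
  `(Σ_{z∈periodBox N}‖a z‖²_HS)·M^{d+4} ≤ 16d²(card n)²64^{4d}·Σ_{y∈periodBox(N·M)}‖g y‖²_HS`.  Test `a∘blk` against the squared-tent bump `h̃ = bump2 M a`
  (`NE3SquaredTentBump`, gen 6): `Σ hsR (a∘blk) h̃ = tentSum2·Σ‖a‖²` with `tentSum2 ≥ (M∕64)^d`, while `Σ hsR (Δ_1g) h̃ = Σ hsR (D_1g)(D_1h̃) ≤ ‖D_1g‖₂‖D_1h̃‖₂`,
  `‖D_1g‖₂² = Σ hsR (Δ_1g) g ≤ ‖a∘blk‖₂‖g‖₂ = M^{d∕2}‖a‖₂‖g‖₂` and `‖D_1h̃‖₂² ≤ 4d·card n·M^{d−2}‖a‖₂²` — so `(M∕64)^{4d}‖a‖₂⁸ ≤ 16d²(card n)²M^{3d−4}‖a‖₂⁶‖g‖₂²`.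

CONTENT (0 sorry; no `def`; [folklore] lattice analysis at the trivial background).  HONEST FRAMING.  Nothing about curved backgrounds or Bałaban's minimisers;
(HR) itself is file 2∕2; `hK`∕(P♮) at curved `W`, `PairLandauGaugeB8Avg`, the covariant root and **NE3 are NOT proved**; spine PROVED 0∕9; finite T⁴ rung (B)+1 —
NOT infinite volume, NOT mass gap, NOT `BetaPertH`, NOT Clay.  PLACEMENT: `Summits/QuantumFields/BalabanUV/T4Continuum/Spine/NE3/`; imports accepted modules only.
-/

set_option autoImplicit false

open scoped BigOperators Matrix Matrix.Norms.L2Operator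
open NormedSpace Finset

namespace Summit.QuantumFields.BalabanUV.T4Continuum.NE3.FlatBlockHarmonicInverse


open Literature.MathematicalPhysics.QuantumFieldTheory.Balaban1983to89
open B7Prop1Explicit B7Prop2Explicit MatrixNorms
open T4AveragingDeficitWall (IsUnitaryCfg IsSkewDir SmallField)
open T4AveragingDeficitWallBoundary (IsPeriodicCfg periodBox mem_periodBox card_periodBox)
open AveragingDeficitPeriodicCounting (IsPeriodicDir)
open AveragingDeficitTorusChart (periodic_smul_vec)
open AveragingDeficitHSInner (nhsNormSq_smul)
open BlockAveragePushDirGauge (gaugeDir isPeriodicDir_gaugeDir)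
open MinimalActionWitness (flatCfg isPeriodicCfg_flatCfg)
open SmoothRefineBlocks (blk blk_res_add_period)
open NE3CovariantCalculus (hsR hsR_self hsR_comm hsR_sub_left hsR_sum_right nhsNormSq_sub nhsNormSq_neg)
open NE3CovariantWeitzenbock (covDiv)
open NE3CovariantBlockMean (bmeanIterW)
open NE3NestedBlockMeanCovariance (bmeanIterW_one)
open NE3FramePotGauge (bmean iterate_bmean_apply)
open NE3TangentNoGoWords (dPot)
open NE3CoarseInterpolant (blk_block)
open NE3BlockLineAverage (sum_periodBox_blocks)
open NE3TentBump (tent)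
open NE3SquaredTentBump (tentSum2 le_tentSum2 bump2 sum_block_tentSq bump2_add_period sum_normSq_dPot_bump2_le)
open NE3FrameFreeDecompositionPrep (hsR_smul_right)
open NE3LandauOrbit (sum_hsR_gaugeDir gaugeDir_skew eq_zero_of_nhsNormSq_eq_zero hsR_zero_right)
open NE3CurvedCornerGaugeSpace (covDiv_mem_skewAdjoint)
open NE3FrameFreeSliceUnique (gaugeDir_flatCfg_eq_neg_dPot eq_zero_of_periodic_of_box)
open NE3FlatHessianCurl (isUnitaryCfg_flatCfg)
open NE3SlicePoincareSkeleton (abs_sum_hsR_le abs_sum_sum_hsR_le)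
open NE3.PairLandauB8 (avgKernelGauges covLapSite)
open NE3.LandauProjectionB8 (covDiv_gaugeDir_eq_covLapSite covLapSite_add_period sum_nhsNormSq_gaugeDir_eq)
open NE3.SlicePoincareSlicB8Flat (flatCfg_eq_one)

noncomputable section

variable {d : ℕ} {n : Type*} [Fintype n] [DecidableEq n]

/-! ## §0 Two flat summation-by-parts identities -/

/-- **SYMMETRY OF `Δ_1` IN `hsR`-SUMS OVER THE PERIOD BOX**: `Σ hsR (Δ_1 f) g = Σ hsR f (Δ_1 g)` for `P`-periodic `f`, `g` (both equal `Σ Σ_κ hsR (D_1f)(D_1g)`).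
[folklore] -/
theorem sum_hsR_covLapSite_comm {P : ℕ} (hP : 1 ≤ P) {f g : Site d → Matrix n n ℂ}
    (hf : ∀ (y : Site d) (i : Fin d), f (y + (P : ℤ) • e i) = f y) (hg : ∀ (y : Site d) (i : Fin d), g (y + (P : ℤ) • e i) = g y) :
    ∑ y ∈ periodBox (d := d) P, hsR (covLapSite (flatCfg (d := d) (n := n)) f y) (g y)
      = ∑ y ∈ periodBox (d := d) P, hsR (f y) (covLapSite (flatCfg (d := d) (n := n)) g y) := by
  have hWu : IsUnitaryCfg (flatCfg (d := d) (n := n)) := isUnitaryCfg_flatCfg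
  have hWP : IsPeriodicCfg (flatCfg (d := d) (n := n)) (P : ℤ) := isPeriodicCfg_flatCfg _
  have h1 := sum_hsR_gaugeDir hP hWu (isPeriodicDir_gaugeDir hWP hf) hg
  have h2 := sum_hsR_gaugeDir hP hWu (isPeriodicDir_gaugeDir hWP hg) hf
  rw [covDiv_gaugeDir_eq_covLapSite] at h1 h2
  rw [← h1]
  have h3 : ∑ x ∈ periodBox (d := d) P, ∑ μ : Fin d, hsR (gaugeDir (flatCfg (d := d) (n := n)) f x μ) (gaugeDir (flatCfg (d := d) (n := n)) g x μ)
      = ∑ x ∈ periodBox (d := d) P, ∑ μ : Fin d, hsR (gaugeDir (flatCfg (d := d) (n := n)) g x μ) (gaugeDir (flatCfg (d := d) (n := n)) f x μ) :=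
    Finset.sum_congr rfl fun x _ => Finset.sum_congr rfl fun μ _ => hsR_comm _ _
  rw [h3, h2]
  exact Finset.sum_congr rfl fun x _ => hsR_comm _ _

/-- **`Σ hsR (Δ_1 f) g = Σ Σ_κ hsR (D_1 f)(D_1 g)`** over the period box for `P`-periodic `f`, `g`. [folklore] -/
theorem sum_hsR_covLapSite_eq_sum_gaugeDir {P : ℕ} (hP : 1 ≤ P) {f g : Site d → Matrix n n ℂ}
    (hf : ∀ (y : Site d) (i : Fin d), f (y + (P : ℤ) • e i) = f y) (hg : ∀ (y : Site d) (i : Fin d), g (y + (P : ℤ) • e i) = g y) :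
    ∑ y ∈ periodBox (d := d) P, hsR (covLapSite (flatCfg (d := d) (n := n)) f y) (g y)
      = ∑ y ∈ periodBox (d := d) P, ∑ κ : Fin d, hsR (gaugeDir (flatCfg (d := d) (n := n)) f y κ) (gaugeDir (flatCfg (d := d) (n := n)) g y κ) := by
  have hWu : IsUnitaryCfg (flatCfg (d := d) (n := n)) := isUnitaryCfg_flatCfg
  have hWP : IsPeriodicCfg (flatCfg (d := d) (n := n)) (P : ℤ) := isPeriodicCfg_flatCfg _
  have h1 := sum_hsR_gaugeDir hP hWu (isPeriodicDir_gaugeDir hWP hf) hg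
  rw [covDiv_gaugeDir_eq_covLapSite] at h1
  exact h1.symm

/-! ## §1 The Laplacian of `g = F + Δ_1μ` is block-constant -/

section BlockHarmonic

variable {L N : ℕ} (hL : 2 ≤ L) (hN : 1 ≤ N) (j : ℕ)
  {g : Site d → Matrix n n ℂ} (hgs : ∀ y : Site d, g y ∈ skewAdjoint (Matrix n n ℂ))
  (hgP : ∀ (y : Site d) (i : Fin d), g (y + ((N * L ^ (j + 1) : ℕ) : ℤ) • e i) = g y)
  (horth : ∀ nu ∈ avgKernelGauges (d := d) (n := n) L N (j + 1) (flatCfg (d := d) (n := n)),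
    ∑ y ∈ periodBox (d := d) (N * L ^ (j + 1)), hsR (g y) (covLapSite (flatCfg (d := d) (n := n)) nu y) = 0)
  (a : Site d → Matrix n n ℂ)
  (ha : ∀ z : Site d, a z = ((((L ^ (j + 1) : ℕ) : ℝ) ^ d)⁻¹ : ℝ) •
    ∑ v ∈ periodBox (d := d) (L ^ (j + 1)), covLapSite (flatCfg (d := d) (n := n)) g (((L ^ (j + 1) : ℕ) : ℤ) • z + v))

include hgP ha in
/-- The block means `a` of `Δ_1 g` are `N`-periodic on the coarse lattice. [folklore] -/
theorem blockMean_add_period (z : Site d) (i : Fin d) : a (z + (N : ℤ) • e i) = a z := by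
  have hWP : IsPeriodicCfg (flatCfg (d := d) (n := n)) ((N * L ^ (j + 1) : ℕ) : ℤ) := isPeriodicCfg_flatCfg _
  have hsum : ∑ v ∈ periodBox (d := d) (L ^ (j + 1)), covLapSite (flatCfg (d := d) (n := n)) g (((L ^ (j + 1) : ℕ) : ℤ) • (z + (N : ℤ) • e i) + v)
      = ∑ v ∈ periodBox (d := d) (L ^ (j + 1)), covLapSite (flatCfg (d := d) (n := n)) g (((L ^ (j + 1) : ℕ) : ℤ) • z + v) := by
    refine Finset.sum_congr rfl fun v _ => ?_
    have he : ((L ^ (j + 1) : ℕ) : ℤ) • (z + (N : ℤ) • e i) + v = (((L ^ (j + 1) : ℕ) : ℤ) • z + v) + ((N * L ^ (j + 1) : ℕ) : ℤ) • e i := by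
      funext l
      simp only [Pi.add_apply, Pi.smul_apply, smul_eq_mul]
      push_cast
      ring
    rw [he, covLapSite_add_period hWP hgP]
  rw [ha, ha, hsum]

include hL hN hgs hgP horth ha in
/-- **THE LAPLACIAN OF `g` IS BLOCK-CONSTANT** (`M = L^{j+1}`): if `g` is skew, `(N·M)`-periodic and `Σ hsR g (Δ_1ν) = 0` for every `ν ∈ N(Q′(1))`, then
`Δ_1 g (y) = a (blk M y)` with `a` the `M`-block means of `Δ_1 g` — `Δ_1g − a∘blk` is a member of `N(Q′(1))` orthogonal to `Δ_1 g` (symmetry of `Δ_1`) and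
to the block-constant `a∘blk`, hence to itself. [folklore] -/
theorem covLapSite_eq_blockMean (y : Site d) :
    covLapSite (flatCfg (d := d) (n := n)) g y = a (blk (L ^ (j + 1)) y) := by
  have hL1 : 1 ≤ L := by omega
  set M : ℕ := L ^ (j + 1) with hM_def
  have hM : 1 ≤ M := Nat.one_le_pow _ _ hL1
  set P : ℕ := N * M with hP_def
  have hP : 1 ≤ P := Nat.mul_pos (by omega) (by omega)
  have hWu : IsUnitaryCfg (flatCfg (d := d) (n := n)) := isUnitaryCfg_flatCfg
  have hWP : IsPeriodicCfg (flatCfg (d := d) (n := n)) (P : ℤ) := isPeriodicCfg_flatCfg _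
  have hMd : (0 : ℝ) < ((M : ℕ) : ℝ) ^ d := pow_pos (by exact_mod_cast hM) d
  have hcard : ((periodBox (d := d) M).card : ℝ) = ((M : ℕ) : ℝ) ^ d := by rw [card_periodBox]; push_cast; ring
  -- `h := Δ_1 g`: skew and periodic
  set h : Site d → Matrix n n ℂ := covLapSite (flatCfg (d := d) (n := n)) g with hh_def
  have hhs : ∀ x : Site d, h x ∈ skewAdjoint (Matrix n n ℂ) := fun x => by
    rw [hh_def, ← covDiv_gaugeDir_eq_covLapSite]; exact covDiv_mem_skewAdjoint hWu (gaugeDir_skew hWu hgs) x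
  have hhP : ∀ (x : Site d) (i : Fin d), h (x + (P : ℤ) • e i) = h x := covLapSite_add_period hWP hgP
  -- `a`: skew and `N`-periodic; `a ∘ blk` is `P`-periodic
  have has : ∀ z : Site d, a z ∈ skewAdjoint (Matrix n n ℂ) := fun z => by
    rw [ha]; exact skewAdjoint.smul_mem _ ((skewAdjoint _).sum_mem fun v _ => hhs _)
  have haP : ∀ (z : Site d) (i : Fin d), a (z + (N : ℤ) • e i) = a z := blockMean_add_period j hgP a ha
  have hblkP : ∀ (x : Site d) (i : Fin d), blk M (x + (P : ℤ) • e i) = blk M x + (N : ℤ) • e i := fun x i => by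
    have h1 := (blk_res_add_period (d := d) hM x (N : ℤ) i).1
    have hPc : (P : ℤ) = (M : ℤ) * (N : ℤ) := by rw [hP_def]; push_cast; ring
    rw [hPc]; exact h1
  -- `w := h − a ∘ blk`
  set w : Site d → Matrix n n ℂ := fun x => h x - a (blk M x) with hw_def
  have hws : ∀ x : Site d, w x ∈ skewAdjoint (Matrix n n ℂ) := fun x => (skewAdjoint _).sub_mem (hhs x) (has _)
  have hwP : ∀ (x : Site d) (i : Fin d), w (x + (P : ℤ) • e i) = w x := fun x i => by
    simp only [hw_def, hhP x i, hblkP x i, haP]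
  -- the block sums of `w` vanish
  have hsum_a : ∀ z : Site d, ∑ v ∈ periodBox (d := d) M, a (blk M ((M : ℤ) • z + v)) = (((M : ℕ) : ℝ) ^ d) • a z := by
    intro z
    rw [Finset.sum_congr rfl fun v hv => by rw [blk_block hM z hv], Finset.sum_const, ← Nat.cast_smul_eq_nsmul ℝ, hcard]
  have hsum_h : ∀ z : Site d, ∑ v ∈ periodBox (d := d) M, h ((M : ℤ) • z + v) = (((M : ℕ) : ℝ) ^ d) • a z := by
    intro z
    rw [ha z, smul_smul, mul_inv_cancel₀ hMd.ne', one_smul]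
  have hwblock : ∀ z : Site d, ∑ v ∈ periodBox (d := d) M, w ((M : ℤ) • z + v) = 0 := by
    intro z
    simp only [hw_def, Finset.sum_sub_distrib, hsum_h z, hsum_a z, sub_self]
  -- `w ∈ N(Q′(1))`
  have hwmean : bmeanIterW L (j + 1) (flatCfg (d := d) (n := n)) w = 0 := by
    funext z
    rw [flatCfg_eq_one, bmeanIterW_one, iterate_bmean_apply hL1 (j + 1) w z, hwblock z, smul_zero]
    rfl
  have hwN : w ∈ avgKernelGauges (d := d) (n := n) L N (j + 1) (flatCfg (d := d) (n := n)) := ⟨hws, hwP, hwmean⟩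
  -- `Σ hsR h w = 0` (symmetry + orthogonality) and `Σ hsR (a∘blk) w = 0` (block sums)
  have h1 : ∑ x ∈ periodBox (d := d) P, hsR (h x) (w x) = 0 := by
    rw [hh_def, sum_hsR_covLapSite_comm hP hgP hwP]
    exact horth w hwN
  have h2 : ∑ x ∈ periodBox (d := d) P, hsR (a (blk M x)) (w x) = 0 := by
    rw [hP_def, Nat.mul_comm, ← sum_periodBox_blocks M N hM]
    refine Finset.sum_eq_zero fun z _ => ?_
    rw [Finset.sum_congr rfl fun v hv => by rw [blk_block hM z hv], ← hsR_sum_right, hwblock z, hsR_zero_right]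
  have h3 : ∑ x ∈ periodBox (d := d) P, nhsNormSq (w x) = 0 := by
    have h4 : ∀ x, nhsNormSq (w x) = hsR (h x) (w x) - hsR (a (blk M x)) (w x) := fun x => by
      rw [← hsR_self, hw_def, hsR_sub_left]
    simp only [h4, Finset.sum_sub_distrib, h1, h2, sub_zero]
  have hbox : ∀ x ∈ periodBox (d := d) P, w x = 0 := by
    have hle := (Finset.sum_eq_zero_iff_of_nonneg fun x _ => nhsNormSq_nonneg (w x)).1 h3
    exact fun x hx => eq_zero_of_nhsNormSq_eq_zero (hle x hx)
  have hw0 : w y = 0 := eq_zero_of_periodic_of_box hP hwP hbox y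
  exact sub_eq_zero.mp hw0

end BlockHarmonic

/-! ## §2 The inverse inequality for block-harmonic fields -/

/-- **THE INVERSE INEQUALITY** (`M ≥ 2`, `N ≥ 1`): if `g` is `(N·M)`-periodic with BLOCK-CONSTANT flat Laplacian `Δ_1 g = a ∘ blk_M`, `a` `N`-periodic, then
`(Σ_{z ∈ periodBox N} ‖a z‖²_HS)·M^{d+4} ≤ 16d²(card n)²·64^{4d}·Σ_{y ∈ periodBox (N·M)} ‖g y‖²_HS` — tested against the squared-tent bump `bump2 M a`. [folklore] -/
theorem blockMean_energy_le {M N : ℕ} (hM : 2 ≤ M) (hN : 1 ≤ N) {g : Site d → Matrix n n ℂ}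
    (hgP : ∀ (y : Site d) (i : Fin d), g (y + ((N * M : ℕ) : ℤ) • e i) = g y)
    {a : Site d → Matrix n n ℂ} (haP : ∀ (z : Site d) (i : Fin d), a (z + (N : ℤ) • e i) = a z)
    (ha : ∀ y : Site d, covLapSite (flatCfg (d := d) (n := n)) g y = a (blk M y)) :
    (∑ z ∈ periodBox (d := d) N, nhsNormSq (a z)) * (M : ℝ) ^ (d + 4)
      ≤ 16 * (d : ℝ) ^ 2 * (Fintype.card n : ℝ) ^ 2 * (64 : ℝ) ^ (4 * d) * ∑ y ∈ periodBox (d := d) (N * M), nhsNormSq (g y) := by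
  have hM1 : 1 ≤ M := by omega
  have hM0 : (0 : ℝ) < M := by exact_mod_cast (by omega : 0 < M)
  set P : ℕ := N * M with hP_def
  have hP : 1 ≤ P := Nat.mul_pos (by omega) (by omega)
  have hPc : P = M * N := Nat.mul_comm _ _
  have hWu : IsUnitaryCfg (flatCfg (d := d) (n := n)) := isUnitaryCfg_flatCfg
  have hWP : IsPeriodicCfg (flatCfg (d := d) (n := n)) (P : ℤ) := isPeriodicCfg_flatCfg _
  set cn : ℝ := (Fintype.card n : ℝ) with hcn_def
  set A : ℝ := ∑ z ∈ periodBox (d := d) N, nhsNormSq (a z) with hA_def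
  set Gn : ℝ := ∑ y ∈ periodBox (d := d) P, nhsNormSq (g y) with hGn_def
  have hA0 : 0 ≤ A := Finset.sum_nonneg fun z _ => nhsNormSq_nonneg _
  have hGn0 : 0 ≤ Gn := Finset.sum_nonneg fun y _ => nhsNormSq_nonneg _
  -- the test function
  set ht : Site d → Matrix n n ℂ := bump2 M a with hht_def
  have hhtP : ∀ (y : Site d) (i : Fin d), ht (y + (P : ℤ) • e i) = ht y := fun y i => by
    rw [hht_def, hPc]; exact bump2_add_period hM1 haP y i
  -- (α) `Σ hsR (Δ_1 g) h̃ = tentSum2 · A`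
  have hα : ∑ y ∈ periodBox (d := d) P, hsR (covLapSite (flatCfg (d := d) (n := n)) g y) (ht y) = tentSum2 d M * A := by
    rw [hPc, ← sum_periodBox_blocks M N hM1]
    have hz : ∀ z ∈ periodBox (d := d) N, ∑ v ∈ periodBox (d := d) M, hsR (covLapSite (flatCfg (d := d) (n := n)) g ((M : ℤ) • z + v)) (ht ((M : ℤ) • z + v))
        = tentSum2 d M * nhsNormSq (a z) := by
      intro z _
      rw [Finset.sum_congr rfl fun v hv => by rw [ha, hht_def, bump2, blk_block hM1 z hv, hsR_smul_right, hsR_self], ← Finset.sum_mul,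
        sum_block_tentSq hM1 z]
    rw [Finset.sum_congr rfl hz, ← Finset.mul_sum]
  -- (β) `Σ hsR (Δ_1 g) h̃ ≤ √E_g · √E_h̃`
  set Eg : ℝ := ∑ y ∈ periodBox (d := d) P, ∑ κ : Fin d, nhsNormSq (gaugeDir (flatCfg (d := d) (n := n)) g y κ) with hEg_def
  set Eh : ℝ := ∑ y ∈ periodBox (d := d) P, ∑ κ : Fin d, nhsNormSq (gaugeDir (flatCfg (d := d) (n := n)) ht y κ) with hEh_def
  have hEg0 : 0 ≤ Eg := Finset.sum_nonneg fun y _ => Finset.sum_nonneg fun κ _ => nhsNormSq_nonneg _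
  have hEh0 : 0 ≤ Eh := Finset.sum_nonneg fun y _ => Finset.sum_nonneg fun κ _ => nhsNormSq_nonneg _
  have hβ : (tentSum2 d M * A) ^ 2 ≤ Eg * Eh := by
    rw [← hα, sum_hsR_covLapSite_eq_sum_gaugeDir hP hgP hhtP, ← sq_abs]
    have hcs := abs_sum_sum_hsR_le P (gaugeDir (flatCfg (d := d) (n := n)) g) (gaugeDir (flatCfg (d := d) (n := n)) ht)
    calc |∑ x ∈ periodBox (d := d) P, ∑ κ : Fin d, hsR (gaugeDir (flatCfg (d := d) (n := n)) g x κ) (gaugeDir (flatCfg (d := d) (n := n)) ht x κ)| ^ 2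
        ≤ (Real.sqrt Eg * Real.sqrt Eh) ^ 2 := pow_le_pow_left₀ (abs_nonneg _) hcs 2
      _ = Eg * Eh := by rw [mul_pow, Real.sq_sqrt hEg0, Real.sq_sqrt hEh0]
  -- (γ) `E_g ≤ √(M^d A) · √Gn`, i.e. `E_g² ≤ M^d · A · Gn`
  have hH : ∑ y ∈ periodBox (d := d) P, nhsNormSq (covLapSite (flatCfg (d := d) (n := n)) g y) = (M : ℝ) ^ d * A := by
    rw [hPc, ← sum_periodBox_blocks M N hM1, hA_def, Finset.mul_sum]
    refine Finset.sum_congr rfl fun z _ => ?_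
    rw [Finset.sum_congr rfl fun v hv => by rw [ha, blk_block hM1 z hv], Finset.sum_const, card_periodBox, nsmul_eq_mul]
    push_cast; ring
  have hγ : Eg ^ 2 ≤ (M : ℝ) ^ d * A * Gn := by
    have h1 : Eg = ∑ y ∈ periodBox (d := d) P, hsR (covLapSite (flatCfg (d := d) (n := n)) g y) (g y) := by
      rw [hEg_def, sum_nhsNormSq_gaugeDir_eq hP hWu hWP hgP]
    have hcs := abs_sum_hsR_le P (covLapSite (flatCfg (d := d) (n := n)) g) g
    rw [hH] at hcs
    have h2 : Eg ≤ Real.sqrt ((M : ℝ) ^ d * A) * Real.sqrt Gn := by rw [h1]; exact (le_abs_self _).trans hcs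
    calc Eg ^ 2 ≤ (Real.sqrt ((M : ℝ) ^ d * A) * Real.sqrt Gn) ^ 2 := pow_le_pow_left₀ hEg0 h2 2
      _ = (M : ℝ) ^ d * A * Gn := by rw [mul_pow, Real.sq_sqrt (mul_nonneg (pow_nonneg hM0.le d) hA0), Real.sq_sqrt hGn0]
  -- (δ) `E_h̃ ≤ 4d · card n · M^{d−2} · A`
  have hδ : Eh ≤ 4 * (d : ℝ) * ((M : ℝ) ^ d / (M : ℝ) ^ 2) * (cn * A) := by
    have h1 : Eh ≤ ∑ y ∈ periodBox (d := d) (M * N), ∑ κ : Fin d, ‖dPot ht y κ‖ ^ 2 := by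
      rw [hEh_def, hPc]
      refine Finset.sum_le_sum fun y _ => Finset.sum_le_sum fun κ _ => ?_
      rw [gaugeDir_flatCfg_eq_neg_dPot, nhsNormSq_neg]
      exact nhsNormSq_le_opNorm_sq _
    have h2 := sum_normSq_dPot_bump2_le (d := d) hM1 N a
    have h3 : ∑ z ∈ periodBox (d := d) N, ‖a z‖ ^ 2 ≤ cn * A := by
      rw [hA_def, Finset.mul_sum]
      exact Finset.sum_le_sum fun z _ => opNorm_sq_le_card_mul_nhsNormSq (a z)
    exact h1.trans (h2.trans (mul_le_mul_of_nonneg_left h3 (by positivity)))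
  -- (ε) algebra: `(T·A)⁴ ≤ E_g²·E_h̃² ≤ M^d A Gn · (4d cn M^{d−2} A)²`, `T ≥ (M∕64)^d`
  have hT := le_tentSum2 hM d
  have hT0 : 0 < ((M : ℝ) / 64) ^ d := by positivity
  have hTA : ((M : ℝ) / 64) ^ d * A ≤ tentSum2 d M * A := mul_le_mul_of_nonneg_right hT hA0
  have hmain : (((M : ℝ) / 64) ^ d * A) ^ 4 ≤ (M : ℝ) ^ d * A * Gn * (4 * (d : ℝ) * ((M : ℝ) ^ d / (M : ℝ) ^ 2) * (cn * A)) ^ 2 := by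
    have h1 : (((M : ℝ) / 64) ^ d * A) ^ 4 ≤ (tentSum2 d M * A) ^ 4 := pow_le_pow_left₀ (mul_nonneg hT0.le hA0) hTA 4
    have h2 : (tentSum2 d M * A) ^ 4 = ((tentSum2 d M * A) ^ 2) ^ 2 := by ring
    have h3 : ((tentSum2 d M * A) ^ 2) ^ 2 ≤ (Eg * Eh) ^ 2 := pow_le_pow_left₀ (sq_nonneg _) hβ 2
    have h4 : (Eg * Eh) ^ 2 = Eg ^ 2 * Eh ^ 2 := by ring
    have h5 : Eg ^ 2 * Eh ^ 2 ≤ ((M : ℝ) ^ d * A * Gn) * (4 * (d : ℝ) * ((M : ℝ) ^ d / (M : ℝ) ^ 2) * (cn * A)) ^ 2 :=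
      mul_le_mul hγ (pow_le_pow_left₀ hEh0 hδ 2) (pow_nonneg hEh0 2) (mul_nonneg (mul_nonneg (pow_nonneg hM0.le d) hA0) hGn0)
    calc (((M : ℝ) / 64) ^ d * A) ^ 4 ≤ (tentSum2 d M * A) ^ 4 := h1
      _ = ((tentSum2 d M * A) ^ 2) ^ 2 := h2
      _ ≤ (Eg * Eh) ^ 2 := h3
      _ = Eg ^ 2 * Eh ^ 2 := h4
      _ ≤ _ := h5
  -- conclude: either `A = 0` or divide by `A³`
  rcases hA0.eq_or_lt with hA | hA
  · rw [← hA]; simp only [zero_mul]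
    have hcn0 : 0 ≤ cn := by rw [hcn_def]; positivity
    exact mul_nonneg (by positivity) hGn0
  · -- rewrite `hmain` as `A³ · (M^{4d}/64^{4d} · A) ≤ A³ · (16 d² cn² M^{3d−4} Gn)`
    have hM2 : (M : ℝ) ^ 2 ≠ 0 := by positivity
    have hlhs : (((M : ℝ) / 64) ^ d * A) ^ 4 = A ^ 3 * ((M : ℝ) ^ (4 * d) / (64 : ℝ) ^ (4 * d) * A) := by
      have e1 : (M : ℝ) ^ (4 * d) = ((M : ℝ) ^ d) ^ 4 := by rw [← pow_mul, mul_comm]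
      have e2 : (64 : ℝ) ^ (4 * d) = ((64 : ℝ) ^ d) ^ 4 := by rw [← pow_mul, mul_comm]
      rw [e1, e2, div_pow]; ring
    have hrhs : (M : ℝ) ^ d * A * Gn * (4 * (d : ℝ) * ((M : ℝ) ^ d / (M : ℝ) ^ 2) * (cn * A)) ^ 2
        = A ^ 3 * (16 * (d : ℝ) ^ 2 * cn ^ 2 * ((M : ℝ) ^ d) ^ 3 / ((M : ℝ) ^ 2) ^ 2 * Gn) := by
      field_simp; ring
    rw [hlhs, hrhs] at hmain
    have hA3 : 0 < A ^ 3 := pow_pos hA 3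
    have hkey := le_of_mul_le_mul_left hmain hA3
    -- `M^{4d}/64^{4d} · A ≤ 16 d² cn² M^{3d}/M⁴ · Gn`  ⟹  `A · M^{d+4} ≤ 16 d² cn² 64^{4d} Gn`
    have h64 : (0 : ℝ) < (64 : ℝ) ^ (4 * d) := by positivity
    rw [div_mul_eq_mul_div, div_le_iff₀ h64] at hkey
    have hpow : (M : ℝ) ^ (4 * d) * A = (A * (M : ℝ) ^ (d + 4)) * ((M : ℝ) ^ d) ^ 3 / ((M : ℝ) ^ 2) ^ 2 := by
      field_simp; ring
    rw [hpow] at hkey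
    have hM34 : (0 : ℝ) < ((M : ℝ) ^ d) ^ 3 / ((M : ℝ) ^ 2) ^ 2 := by positivity
    have hkey2 : (A * (M : ℝ) ^ (d + 4)) * (((M : ℝ) ^ d) ^ 3 / ((M : ℝ) ^ 2) ^ 2)
        ≤ (16 * (d : ℝ) ^ 2 * cn ^ 2 * (64 : ℝ) ^ (4 * d) * Gn) * (((M : ℝ) ^ d) ^ 3 / ((M : ℝ) ^ 2) ^ 2) := by
      have : 16 * (d : ℝ) ^ 2 * cn ^ 2 * ((M : ℝ) ^ d) ^ 3 / ((M : ℝ) ^ 2) ^ 2 * Gn * (64 : ℝ) ^ (4 * d)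
          = (16 * (d : ℝ) ^ 2 * cn ^ 2 * (64 : ℝ) ^ (4 * d) * Gn) * (((M : ℝ) ^ d) ^ 3 / ((M : ℝ) ^ 2) ^ 2) := by ring
      rw [mul_div_assoc] at hkey
      linarith [hkey, this]
    exact le_of_mul_le_mul_right hkey2 hM34

end

end Summit.QuantumFields.BalabanUV.T4Continuum.NE3.FlatBlockHarmonicInverse
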